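import Literature.MathematicalPhysics.QuantumLattice.HubbardModel
import Literature.MathematicalPhysics.QuantumLattice.HubbardWave0LiebProofs
import Literature.MathematicalPhysics.QuantumLattice.HubbardModelSpinProofs
import HarnessLib

/-!
# The Hubbard torus with an Aharonov–Bohm flux through one cycle

Trunk T-QLATTICE (family `hubbard`; consumers: route `FluxSpectroscopy` of
`Summits/HubbardSuperconductivity`, items FluxBridge / FluxWindow / KleinSelection /
OverlapNondegeneracy / BlochBound, which inline the present definition as their `let ET` body).

## Contents

* `hubbardTorusFlux L U θ` — the Hubbard Hamiltonian `H(t = 1, U)` on the fermionic torus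
  `(ℤ/Lℤ)²` (`hubbardTorus 2 L 1 U`) with an Aharonov–Bohm flux `θ` threaded through the
  `e₁`-cycle, realised by Peierls phases on the *seam* bonds `{x₁ = L-1} → {x₁ = 0}` only: the
  hopping amplitude `-1` of `c†_{(0,y)σ} c_{(L-1,y)σ}` becomes `-e^{iθ}` and that of its adjoint
  `-e^{-iθ}` (twisted boundary condition; Byers–Yang, Kohn, Shastry–Sutherland, Scalapino–White–Zhang,
  Watanabe). Written as `hubbardTorus 2 L 1 U + seamTwist L θ` with the seam correction
  `seamTwist L θ = Σ_{y,σ} [(1 - e^{iθ}) c†_{(0,y)σ} c_{(L-1,y)σ} + (1 - e^{-iθ}) c†_{(L-1,y)σ} c_{(0,y)σ}]`,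
  the sum over the two orientations being indexed by `b : Bool` — *literally* the expression
  inlined in the route file, so that the route's sector energy is `fluxEnergy` by `rfl`.
* `fluxEnergy L U δ θ` — the lowest energy of `hubbardTorusFlux L U θ` in the sector of
  `N_L = 2⌊(1-δ)L²/2⌋` electrons and `S^z = 0` (`Matrix.minEnergyOn`, `szSector`): the
  Byers–Yang / Scalapino–White–Zhang flux envelope `E_L(θ)` whose curvature is the superfluid weight.
* API, all proved: `θ = 0` gives back `hubbardTorus 2 L 1 U`; `2π`-periodicity in `θ`;
  hermiticity; conservation of `N↑`, `N↓` (`PreservesSectors`), hence `[H(θ), N] = [H(θ), S^z] = 0`,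
  and full spin-rotation invariance `[H(θ), S^α] = 0`; time reversal = complex conjugation:
  `conj H(θ) = H(-θ)` entrywise, the sectors `szSector N M` are closed under conjugation, and
  consequently every sector energy is even in `θ` (`minEnergyOn_map_conj`, `fluxEnergy_neg`).
  Not here: the gauge covariance spreading the seam phase to `e^{iθ/L}` on every `+e₁` bond
  (Peierls form, companion file `HubbardTorusFluxGauge.lean`).

## Mathlib search

Mathlib has no Fock space / Hubbard model (`lean search 'Peierls|twistedHopping|flux'` in the
fermion files: nothing); reused from the tree: `hubbardTorus`, `FermionTorus.ofTorusSite`,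
`creation`, `annihilation`, `szSector`, `Matrix.minEnergyOn`, `PreservesSectors` and the Lieb
sector machinery (`LiebThm1.preservesSectors_hopping`, `LiebThm1.totalNumber_eq_diagonal`,
`LiebThm1.spinZ_eq_diagonal`, `LiebThm1.sum_hopping_commute_spinPlus`), `commute_spinVecF_of_commute`;
Mathlib API `Fintype.sum_bool`, `Complex.exp_conj`, `Complex.exp_two_pi_mul_I`, `Matrix.map_mul`.

## Design notes

* Degenerate sides: for `L = 1` the two seam columns coincide and `seamTwist 1 θ = (2 - 2cos θ) N`
  is an on-site term; for `L = 2` the seam bond is the unique `e₁`-bond of each row. All lemmas of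
  this file hold for every `L ≥ 1`; only the identification with a Peierls Hamiltonian
  (companion file) needs `L ≥ 2`.
* Sign convention: the route's `θ` is minus Watanabe's (`t e^{-iθ} c†_{x+1} c_x`, Watanabe 2019
  §2.2.3); immaterial by `fluxEnergy_neg`.

## Sources

Byers–Yang, PRL 7 (1961) 46 [ByersYang1961]; Kohn, Phys. Rev. 133 (1964) A171 [Kohn1964];
Shastry–Sutherland, PRL 65 (1990) 243 [ShastrySutherland1990]; Scalapino–White–Zhang, PRB 47 (1993)
7995 [ScalapinoWhiteZhang1993]; Watanabe, J. Stat. Phys. 177 (2019) 717, §2.2.3, §4.1 [Watanabe2019];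
Tada–Koma, J. Stat. Phys. 165 (2016) 455, §4 [TadaKoma2016]; Essler–Frahm–Göhmann–Klümper–Korepin,
*The One-Dimensional Hubbard Model* (2005) §8.4.3 [EsslerEtAl2005].
-/

noncomputable section

namespace Literature.MathematicalPhysics.QuantumLattice

open Matrix Finset HubbardWave0 Literature.Probability.LatticeModels
open scoped ComplexOrder

/-! ### The seam-twisted Hubbard torus -/

section Defs

variable (L : ℕ) [NeZero L]

/-- The **seam twist** (Peierls correction) carrying a flux `θ` through the `e₁`-cycle of the
fermionic torus `(ℤ/Lℤ)²`: for every row `y : ZMod L` and spin `σ`,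
`(1 - e^{iθ}) c†_{(0,y)σ} c_{(-1,y)σ}` (`b = true`) plus `(1 - e^{-iθ}) c†_{(-1,y)σ} c_{(0,y)σ}`
(`b = false`). Added to the `t = 1` Hubbard torus it replaces the seam hopping amplitudes `-1` by
`-e^{± iθ}` (Watanabe 2019 §2.2.3: "every term … across the seam acquires a phase"; Tada–Koma 2016
§4: `t̃_{x,y} = t_{x,y} e^{iA_{x,y}}`). [cite: Watanabe2019, §2.2.3 and §4.1] -/
def seamTwist (θ : ℝ) :
    Matrix (Finset (Orb (FermionTorus 2 L))) (Finset (Orb (FermionTorus 2 L))) ℂ :=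
  ∑ y : ZMod L, ∑ σ : Fin 2, ∑ b : Bool,
    (1 - Complex.exp ((if b then 1 else -1) * Complex.I * θ)) •
      (creation (orb (FermionTorus.ofTorusSite ![if b then 0 else -1, y]) σ) *
        annihilation (orb (FermionTorus.ofTorusSite ![if b then -1 else 0, y]) σ))

/-- The **Hubbard torus with flux `θ` through the `e₁`-cycle** (`d = 2`, `t = 1`): the Hubbard
Hamiltonian `hubbardTorus 2 L 1 U` on `(ℤ/Lℤ)²` whose hoppings across the seam
`{x₁ = -1} → {x₁ = 0}` carry the Peierls phase, `-c†_{(0,y)σ} c_{(-1,y)σ} ↦ -e^{iθ} c†_{(0,y)σ} c_{(-1,y)σ}`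
(and adjoint), i.e. `hubbardTorus 2 L 1 U + seamTwist L θ`, written out literally as in route
`FluxSpectroscopy`. Twisted boundary conditions / flux threading: Byers–Yang (1961), Kohn (1964)
§II, Shastry–Sutherland (1990), Scalapino–White–Zhang (1993); lattice form as in Watanabe (2019)
§2.2.3, §4.1. [cite: Watanabe2019, §2.2.3 and §4.1] -/
def hubbardTorusFlux (U θ : ℝ) :
    Matrix (Finset (Orb (FermionTorus 2 L))) (Finset (Orb (FermionTorus 2 L))) ℂ :=
  hubbardTorus 2 L 1 U + ∑ y : ZMod L, ∑ σ : Fin 2, ∑ b : Bool,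
    (1 - Complex.exp ((if b then 1 else -1) * Complex.I * θ)) •
      (creation (orb (FermionTorus.ofTorusSite ![if b then 0 else -1, y]) σ) *
        annihilation (orb (FermionTorus.ofTorusSite ![if b then -1 else 0, y]) σ))

/-- The **flux envelope** `E^T_L(U, δ; θ)`: the lowest energy of `hubbardTorusFlux L U θ` in the
joint sector of `N_L = 2⌊(1-δ)L²/2⌋` electrons and `S^z = 0` (`Matrix.minEnergyOn` of
`szSector`; the sector minimum, so its stiffness in `θ` is the superfluid weight `D_s` of
Scalapino–White–Zhang 1993, not the Drude weight; Byers–Yang 1961). Flux through the ring,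
`ΔE(φ) ∝ φ²`, current `j(φ) = ∂E/∂φ`: Essler et al. (2005) §8.4.3.
[cite: EsslerEtAl2005, §8.4.3 eqs. (8.108)–(8.110)] -/
def fluxEnergy (U δ θ : ℝ) : ℝ :=
  (hubbardTorusFlux L U θ).minEnergyOn (szSector (2 * ⌊(1 - δ) * (L : ℝ) ^ 2 / 2⌋₊) 0)

/-- `hubbardTorusFlux` is the Hubbard torus plus the seam twist (definitional). [folklore] -/
theorem hubbardTorusFlux_eq (U θ : ℝ) :
    hubbardTorusFlux L U θ = hubbardTorus 2 L 1 U + seamTwist L θ := rfl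

/-- `seamTwist` unfolded (definitional). [folklore] -/
theorem seamTwist_eq (θ : ℝ) :
    seamTwist L θ = ∑ y : ZMod L, ∑ σ : Fin 2, ∑ b : Bool,
      (1 - Complex.exp ((if b then 1 else -1) * Complex.I * θ)) •
        (creation (orb (FermionTorus.ofTorusSite ![if b then 0 else -1, y]) σ) *
          annihilation (orb (FermionTorus.ofTorusSite ![if b then -1 else 0, y]) σ)) := rfl

/-- `fluxEnergy` unfolded (definitional). [folklore] -/
theorem fluxEnergy_eq (U δ θ : ℝ) :
    fluxEnergy L U δ θ =
      (hubbardTorusFlux L U θ).minEnergyOn (szSector (2 * ⌊(1 - δ) * (L : ℝ) ^ 2 / 2⌋₊) 0) := rfl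

/-! ### Zero flux and `2π`-periodicity -/

/-- At zero flux the seam twist vanishes (`1 - e^0 = 0`). [folklore] -/
@[simp] theorem seamTwist_zero : seamTwist L 0 = 0 := by
  simp [seamTwist]

/-- At zero flux the twisted torus is the Hubbard torus `hubbardTorus 2 L 1 U`. [folklore] -/
@[simp] theorem hubbardTorusFlux_zero (U : ℝ) : hubbardTorusFlux L U 0 = hubbardTorus 2 L 1 U := by
  rw [hubbardTorusFlux_eq, seamTwist_zero, add_zero]

/-- The Peierls factors `e^{± iθ}` are `2π`-periodic in `θ`. [folklore] -/
theorem exp_sign_mul_I_mul_add_two_pi (b : Bool) (θ : ℝ) :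
    Complex.exp ((if b then 1 else -1) * Complex.I * ((θ + 2 * Real.pi : ℝ) : ℂ)) =
      Complex.exp ((if b then 1 else -1) * Complex.I * θ) := by
  have h : (if b then 1 else -1) * Complex.I * ((θ + 2 * Real.pi : ℝ) : ℂ) =
      (if b then 1 else -1) * Complex.I * θ + (if b then 1 else -1) * (2 * Real.pi * Complex.I) := by
    push_cast; ring
  rw [h, Complex.exp_add]
  cases b
  · simp [Complex.exp_neg, Complex.exp_two_pi_mul_I]
  · simp [Complex.exp_two_pi_mul_I]

/-- The seam twist is `2π`-periodic in the flux (only `e^{± iθ}` enters). [folklore] -/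
theorem seamTwist_periodic : Function.Periodic (seamTwist L) (2 * Real.pi) := by
  intro θ
  simp only [seamTwist, exp_sign_mul_I_mul_add_two_pi]

/-- The twisted torus is `2π`-periodic in the flux: `H(θ + 2π) = H(θ)` (flux quantum `2π` in
units `ħ = e = 1`; Byers–Yang 1961). [folklore] -/
theorem hubbardTorusFlux_periodic (U : ℝ) : Function.Periodic (hubbardTorusFlux L U) (2 * Real.pi) := by
  intro θ
  rw [hubbardTorusFlux_eq, hubbardTorusFlux_eq, seamTwist_periodic]

/-- Hence every flux envelope is `2π`-periodic (Byers–Yang 1961). [folklore] -/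
theorem fluxEnergy_periodic (U δ : ℝ) : Function.Periodic (fluxEnergy L U δ) (2 * Real.pi) := by
  intro θ
  rw [fluxEnergy_eq, fluxEnergy_eq, hubbardTorusFlux_periodic]

/-! ### Hermiticity -/

/-- The adjoint of one oriented seam term is the oppositely oriented one:
`((1 - e^{iθ}) c†_{(0,y)σ} c_{(-1,y)σ})ᴴ = (1 - e^{-iθ}) c†_{(-1,y)σ} c_{(0,y)σ}`. [folklore] -/
theorem seamTerm_conjTranspose (θ : ℝ) (y : ZMod L) (σ : Fin 2) (b : Bool) :
    ((1 - Complex.exp ((if b then 1 else -1) * Complex.I * θ)) •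
        (creation (orb (FermionTorus.ofTorusSite ![if b then 0 else -1, y]) σ) *
          annihilation (orb (FermionTorus.ofTorusSite ![if b then -1 else 0, y]) σ)) :
        Matrix (Finset (Orb (FermionTorus 2 L))) (Finset (Orb (FermionTorus 2 L))) ℂ)ᴴ =
      (1 - Complex.exp ((if !b then 1 else -1) * Complex.I * θ)) •
        (creation (orb (FermionTorus.ofTorusSite ![if !b then 0 else -1, y]) σ) *
          annihilation (orb (FermionTorus.ofTorusSite ![if !b then -1 else 0, y]) σ)) := by
  rw [conjTranspose_smul, conjTranspose_mul, creation_conjTranspose, annihilation_conjTranspose]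
  have hc : star (1 - Complex.exp ((if b then 1 else -1) * Complex.I * θ)) =
      1 - Complex.exp ((if !b then 1 else -1) * Complex.I * θ) := by
    rw [Complex.star_def, map_sub, map_one, ← Complex.exp_conj, map_mul, map_mul, Complex.conj_I,
      Complex.conj_ofReal]
    cases b <;> simp
  rw [hc]
  cases b <;> simp

/-- The seam twist is Hermitian (the two orientations are each other's adjoints). [folklore] -/
theorem isHermitian_seamTwist (θ : ℝ) : (seamTwist L θ).IsHermitian := by
  unfold IsHermitian seamTwist
  simp only [conjTranspose_sum]
  refine Finset.sum_congr rfl fun y _ => Finset.sum_congr rfl fun σ _ => ?_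
  rw [Fintype.sum_bool, Fintype.sum_bool, seamTerm_conjTranspose, seamTerm_conjTranspose, add_comm]
  rfl

/-- The twisted torus `H(θ)` is Hermitian. Scalapino–White–Zhang (1993) §II. [folklore] -/
theorem isHermitian_hubbardTorusFlux (U θ : ℝ) : (hubbardTorusFlux L U θ).IsHermitian :=
  (hamiltonian_isHermitian_and_commute_holds (fermionTorusGraph 2 L) 1 U).1.add
    (isHermitian_seamTwist L θ)

/-! ### Conservation laws: `N↑`, `N↓`, `N`, `S^z`, and spin rotations -/

/-- The seam twist conserves `N↑` and `N↓` (it is a sum of spin-diagonal hoppings). [folklore] -/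
theorem preservesSectors_seamTwist (θ : ℝ) : PreservesSectors (seamTwist L θ) :=
  PreservesSectors.sum fun _ _ => PreservesSectors.sum fun σ _ => PreservesSectors.sum fun _ _ =>
    (LiebThm1.preservesSectors_hopping _ _ σ).smul _

/-- The twisted torus conserves `N↑` and `N↓`: it is block diagonal in the sectors `(N↑, N↓)`,
exactly like the untwisted Hubbard Hamiltonian. [folklore] -/
theorem preservesSectors_hubbardTorusFlux (U θ : ℝ) : PreservesSectors (hubbardTorusFlux L U θ) :=
  (LiebThm1.preservesSectors_hamiltonian (fermionTorusGraph 2 L) 1 U).add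
    (preservesSectors_seamTwist L θ)

/-- `[H(θ), N] = 0`: the flux couples to a conserved charge. Watanabe (2019) §2.1 (the twisted
Hamiltonian commutes with `N`). [cite: Watanabe2019, §2.1] -/
theorem hubbardTorusFlux_commute_totalNumber (U θ : ℝ) :
    Commute (hubbardTorusFlux L U θ) totalNumber := by
  rw [LiebThm1.totalNumber_eq_diagonal]
  exact (preservesSectors_hubbardTorusFlux L U θ).commute_diagonal fun a b => ((a + b : ℕ) : ℂ)

/-- `[H(θ), S^z] = 0`. [folklore] -/
theorem hubbardTorusFlux_commute_spinZ (U θ : ℝ) :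
    Commute (hubbardTorusFlux L U θ) spinZ := by
  rw [LiebThm1.spinZ_eq_diagonal]
  exact (preservesSectors_hubbardTorusFlux L U θ).commute_diagonal
    fun a b => (1 / 2 : ℂ) * ((a : ℂ) - (b : ℂ))

/-- The seam twist commutes with `S⁺` (both spin species carry the same Peierls phase, so the
spin-summed seam hopping is `SU(2)`-invariant). [folklore] -/
theorem seamTwist_commute_spinPlus (θ : ℝ) : Commute (seamTwist L θ) spinPlus := by
  unfold seamTwist
  refine Commute.sum_left _ _ _ fun y _ => ?_
  rw [Finset.sum_comm]
  refine Commute.sum_left _ _ _ fun b _ => ?_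
  rw [← Finset.smul_sum]
  exact (LiebThm1.sum_hopping_commute_spinPlus _ _).smul_left _

/-- `[H(θ), S⁺] = 0`. [folklore] -/
theorem hubbardTorusFlux_commute_spinPlus (U θ : ℝ) : Commute (hubbardTorusFlux L U θ) spinPlus :=
  (LiebThm1.hamiltonian_commute_spinPlus (fermionTorusGraph 2 L) 1 U).add_left
    (seamTwist_commute_spinPlus L θ)

/-- `[H(θ), S⁻] = 0` (adjoint of `[H(θ), S⁺] = 0`, `H(θ)` being Hermitian). [folklore] -/
theorem hubbardTorusFlux_commute_spinMinus (U θ : ℝ) :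
    Commute (hubbardTorusFlux L U θ) spinMinus := by
  have h := hubbardTorusFlux_commute_spinPlus L U θ
  rw [Commute, SemiconjBy] at h ⊢
  have h' := congrArg conjTranspose h
  rw [conjTranspose_mul, conjTranspose_mul, (isHermitian_hubbardTorusFlux L U θ).eq] at h'
  exact h'.symm

/-- **Spin-rotation invariance of the twisted torus**: `[H(θ), S^α] = 0` for `α = x, y, z` — the
Aharonov–Bohm flux couples to the charge `U(1)` only. [folklore] -/
theorem hubbardTorusFlux_commute_spinVecF (U θ : ℝ) (α : Fin 3) :
    Commute (hubbardTorusFlux L U θ) (spinVecF α) :=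
  commute_spinVecF_of_commute (hubbardTorusFlux_commute_spinPlus L U θ)
    (hubbardTorusFlux_commute_spinMinus L U θ) (hubbardTorusFlux_commute_spinZ L U θ) α

end Defs

/-! ### Time reversal: complex conjugation sends `θ` to `-θ` -/

section Conj

variable {m : Type*}

/-- Entrywise complex conjugation commutes with finite sums of matrices. [folklore] -/
theorem map_conj_sum {κ : Type*} (s : Finset κ) (M : κ → Matrix m m ℂ) :
    (∑ k ∈ s, M k).map (starRingEnd ℂ) = ∑ k ∈ s, (M k).map (starRingEnd ℂ) := by
  ext a b; simp [Matrix.sum_apply, map_sum]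

/-- Entrywise complex conjugation of a scalar multiple. [folklore] -/
theorem map_conj_smul (c : ℂ) (M : Matrix m m ℂ) :
    (c • M).map (starRingEnd ℂ) = starRingEnd ℂ c • M.map (starRingEnd ℂ) := by
  ext a b; simp

/-- Entrywise complex conjugation of a guarded term. [folklore] -/
theorem map_conj_ite (p : Prop) [Decidable p] (M : Matrix m m ℂ) :
    (if p then M else 0).map (starRingEnd ℂ) = if p then M.map (starRingEnd ℂ) else 0 := by
  split_ifs; exacts [rfl, Matrix.map_zero _ (map_zero _)]

/-- Conjugating twice is the identity. [folklore] -/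
theorem map_conj_map_conj (M : Matrix m m ℂ) :
    (M.map (starRingEnd ℂ)).map (starRingEnd ℂ) = M := by
  ext a b; simp

variable {ι : Type*} [LinearOrder ι]

/-- The Jordan–Wigner annihilation matrices are real (entries `0, ±1`). [folklore] -/
theorem annihilation_map_conj (i : ι) :
    (annihilation i : Matrix (Finset ι) (Finset ι) ℂ).map (starRingEnd ℂ) = annihilation i := by
  ext s t
  simp only [map_apply, annihilation_apply]
  split_ifs <;> simp [jwSign]

/-- The Jordan–Wigner creation matrices are real (entries `0, ±1`). [folklore] -/
theorem creation_map_conj (i : ι) :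
    (creation i : Matrix (Finset ι) (Finset ι) ℂ).map (starRingEnd ℂ) = creation i := by
  ext s t
  simp only [map_apply, creation_apply]
  split_ifs <;> simp [jwSign]

variable {Λ : Type*} [LinearOrder Λ] [Fintype Λ] (G : SimpleGraph Λ) [DecidableRel G.Adj]

/-- The Hubbard Hamiltonian is a real matrix in the occupation basis (real `t`, `U`; real
Jordan–Wigner matrices): `conj H = H` entrywise. Lieb, PRL 62 (1989) 1201 (the hopping matrix
"is real"). [folklore] -/
theorem hamiltonian_map_conj (t U : ℝ) :
    (hamiltonian G t U).map (starRingEnd ℂ) = hamiltonian G t U := by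
  unfold hamiltonian numberOp
  rw [Matrix.map_add _ (map_add _), map_conj_smul, map_conj_smul]
  simp only [map_conj_sum, map_conj_ite, Matrix.map_mul, creation_map_conj, annihilation_map_conj,
    map_neg, Complex.conj_ofReal]

variable (L : ℕ) [NeZero L]

/-- Complex conjugation reverses the flux of the seam twist: `conj (seamTwist θ) = seamTwist (-θ)`
(`conj (1 - e^{iθ}) = 1 - e^{-iθ}`, the hopping matrices being real). [folklore] -/
theorem seamTwist_map_conj (θ : ℝ) :
    (seamTwist L θ).map (starRingEnd ℂ) = seamTwist L (-θ) := by
  unfold seamTwist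
  simp only [map_conj_sum, map_conj_smul, Matrix.map_mul, creation_map_conj, annihilation_map_conj]
  refine Finset.sum_congr rfl fun y _ => Finset.sum_congr rfl fun σ _ =>
    Finset.sum_congr rfl fun b _ => ?_
  congr 1
  rw [map_sub, map_one, ← Complex.exp_conj, map_mul, map_mul, Complex.conj_I, Complex.conj_ofReal]
  congr 2
  cases b <;> simp

/-- **Time reversal**: complex conjugation maps the torus with flux `θ` to the torus with flux
`-θ`, `conj H(θ) = H(-θ)` entrywise (`H(0)` is real). Byers–Yang (1961) (`E(-Φ) = E(Φ)`).
[folklore] -/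
theorem hubbardTorusFlux_map_conj (U θ : ℝ) :
    (hubbardTorusFlux L U θ).map (starRingEnd ℂ) = hubbardTorusFlux L U (-θ) := by
  rw [hubbardTorusFlux_eq, hubbardTorusFlux_eq, Matrix.map_add _ (map_add _), seamTwist_map_conj,
    hubbardTorus, hamiltonian_map_conj]

omit [Fintype Λ] in
/-- The joint sectors `(N, S^z = M)` are closed under complex conjugation of the coefficients
(they are spanned by occupation-basis vectors). [folklore] -/
theorem star_mem_szSector [Fintype Λ] {N : ℕ} {M : ℝ} {ψ : Fock (Orb Λ)} (h : ψ ∈ szSector N M) :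
    star ψ ∈ szSector N M := by
  rw [mem_szSector_iff] at h ⊢
  obtain ⟨hN, hZ⟩ := h
  refine ⟨fun s hs => by rw [Pi.star_apply, hN s hs, star_zero], ?_⟩
  funext s
  have hs := congrFun hZ s
  rw [LiebThm1.spinZ_mulVec_apply, Pi.smul_apply, smul_eq_mul] at hs ⊢
  rw [Pi.star_apply]
  by_cases h0 : ψ s = 0
  · rw [h0, star_zero, mul_zero, mul_zero]
  · rw [mul_right_cancel₀ h0 hs]

/-- Conjugating the matrix conjugates the quadratic form: `⟨ψ̄, Ā ψ̄⟩ = conj ⟨ψ, A ψ⟩`. [folklore] -/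
theorem star_star_dotProduct_map_conj_mulVec [Fintype m] (A : Matrix m m ℂ) (ψ : m → ℂ) :
    star (star ψ) ⬝ᵥ A.map (starRingEnd ℂ) *ᵥ star ψ = star (star ψ ⬝ᵥ A *ᵥ ψ) := by
  have h1 : A.map (starRingEnd ℂ) *ᵥ star ψ = star (A *ᵥ ψ) := by
    funext i
    simp [Matrix.mulVec, dotProduct, star_sum]
  rw [h1, star_dotProduct, star_star, dotProduct_comm]

/-- The variational energies of `conj A` on a conjugation-closed sector are among those of `A`
(test `conj A` on `ψ̄`). [folklore] -/
theorem energySet_map_conj_subset [Fintype m] (A : Matrix m m ℂ) (K : Submodule ℂ (m → ℂ))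
    (hK : ∀ ψ ∈ K, star ψ ∈ K) :
    {E : ℝ | ∃ ψ ∈ K, star ψ ⬝ᵥ ψ = 1 ∧ E = (star ψ ⬝ᵥ A.map (starRingEnd ℂ) *ᵥ ψ).re} ⊆
      {E : ℝ | ∃ ψ ∈ K, star ψ ⬝ᵥ ψ = 1 ∧ E = (star ψ ⬝ᵥ A *ᵥ ψ).re} := by
  rintro E ⟨ψ, hψ, hn, rfl⟩
  refine ⟨star ψ, hK ψ hψ, ?_, ?_⟩
  · rw [star_star, dotProduct_comm, hn]
  · have h := star_star_dotProduct_map_conj_mulVec (A.map (starRingEnd ℂ)) ψ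
    rw [map_conj_map_conj] at h
    rw [h, Complex.star_def, Complex.conj_re]

/-- **Conjugation invariance of sector energies**: on a sector closed under complex conjugation,
`conj A` and `A` have the same lowest variational energy (`Matrix.minEnergyOn`). [folklore] -/
theorem minEnergyOn_map_conj [Fintype m] [DecidableEq m] (A : Matrix m m ℂ) (K : Submodule ℂ (m → ℂ))
    (hK : ∀ ψ ∈ K, star ψ ∈ K) :
    (A.map (starRingEnd ℂ)).minEnergyOn K = A.minEnergyOn K := by
  unfold Matrix.minEnergyOn
  congr 1
  refine Set.Subset.antisymm (energySet_map_conj_subset A K hK) ?_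
  have h := energySet_map_conj_subset (A.map (starRingEnd ℂ)) K hK
  rwa [map_conj_map_conj] at h

/-- **`E(-θ) = E(θ)` in every sector**: the lowest energy of the twisted torus in any joint sector
`(N, S^z = M)` is even in the flux (time reversal = complex conjugation preserves the sector and
reverses the flux; Byers–Yang 1961). [folklore] -/
theorem minEnergyOn_hubbardTorusFlux_neg (U θ : ℝ) (N : ℕ) (M : ℝ) :
    (hubbardTorusFlux L U (-θ)).minEnergyOn (szSector N M) =
      (hubbardTorusFlux L U θ).minEnergyOn (szSector N M) := by
  rw [← hubbardTorusFlux_map_conj]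
  exact minEnergyOn_map_conj _ _ fun ψ h => star_mem_szSector h

/-- The flux envelope is even: `E^T_L(U, δ; -θ) = E^T_L(U, δ; θ)` (Byers–Yang 1961). [folklore] -/
theorem fluxEnergy_neg (U δ θ : ℝ) : fluxEnergy L U δ (-θ) = fluxEnergy L U δ θ :=
  minEnergyOn_hubbardTorusFlux_neg L U θ _ _

end Conj

end Literature.MathematicalPhysics.QuantumLattice
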